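import Literature.MathematicalPhysics.StatisticalMechanics.StickyChain
import Literature.MathematicalPhysics.StatisticalMechanics.CrystallizationLocalLimit
import Literature.Algebra.EuclideanLattices.IntegerBases
import HarnessLib

/-!
# Sticky particles on a line crystallize onto `ℤ`

Topic: `Literature/MathematicalPhysics/StatisticalMechanics`. A **positive instance of the
Blanc–Lewin crystallization statement** `IsCrystallizing` and of the energetic statement
`HasPeriodicGroundStateEnergy` of `Crystallization.lean`, in dimension `d = 1` for the sticky
potential `stickyPotential` (`StickyChain.lean`; Blanc–Lewin 2015, §2.3 (24)):

* `intChain : PeriodicConfiguration 1` — the integer chain `ℤ ⊂ ℝ¹` (lattice of periods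
  `ℤ¹ = stdIntLattice 1`, one-point motif `{0}`); `mem_points_intChain`.
* `isCrystallizing_stickyPotential_one : IsCrystallizing stickyPotential 1` — every sequence of
  ground states (unit chains, `IsGroundState.exists_eq_add_of_stickyPotential`), translated so
  that the particle of rank `⌊N/2⌋` sits at the origin, converges locally to `∑_{k ∈ ℤ} δ_k`
  (multiplicity `m ≡ 1`, full sequence `φ = id`), by the exact-matching criterion
  `PeriodicConfiguration.tendsto_sum_of_eventually_card_eq`.
* `hasPeriodicGroundStateEnergy_stickyPotential_one : HasPeriodicGroundStateEnergy
  stickyPotential 1` — `E(N)/N = -(N-1)/N → -1 = e(ℤ)`, and `e(Q) ≥ -1` for every periodic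
  configuration `Q` of the line (each particle has at most two others at distance exactly `1`:
  the kissing number of `ℝ¹`), so `e(ℤ) = min_Q e(Q)`.
* `crystallization_stickyPotential_one` — the conjunction, i.e. the exact `d = 1` sticky
  analogue of the summit conjunct `Crystallization` (which is this conjunction for
  Lennard-Jones in `d = 3`, open: Blanc–Lewin 2015, §2.3).

Together with `not_isCrystallizing_zero` (`Crystallization.lean`, appendix) this certifies in
Lean that `IsCrystallizing V d` is a genuine, satisfiable, potential-dependent predicate — the
statement of the crystallization conjecture — and not a fact admitting a uniform proof.

## Sources

* X. Blanc, M. Lewin, *The crystallization conjecture: a review*, EMS Surv. Math. Sci. 2 (2015),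
  255–306, arXiv:1504.01153: §1.3 (8), §2.1 (15)–(17), (23), §2.3 (24).
* R. C. Heitmann, C. Radin, *The ground state for sticky disks*, J. Stat. Phys. 22 (1980),
  281–287 (the `d = 2` theorem whose one-dimensional shadow this file proves).

## Design notes

* `energyPerParticle` is a `tsum` over `{y ∈ F + G, y ≠ x}`; for the sticky potential the
  summand vanishes beyond distance `1`, so the sum is a finite sum
  (`PeriodicConfiguration.tsum_stickyPotential_eq_sum`) and no junk value enters.
* [folklore] throughout: elementary; the cited sources treat `d ≥ 2`.
-/

noncomputable section

open scoped BigOperators Topology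
open Filter Set Metric

namespace Literature.MathematicalPhysics.StatisticalMechanics

open StickyChain Literature.Algebra.EuclideanLattices

/-! ## The integer chain -/

/-- The integer chain `ℤ ⊂ ℝ¹` as a periodic (Bravais) configuration: lattice of periods
`ℤ¹ = stdIntLattice 1`, motif `{0}`. [folklore] -/
def intChain : PeriodicConfiguration 1 where
  lattice := stdIntLattice 1
  discrete := inferInstance
  isZLattice := inferInstance
  motif := {0}
  motif_nonempty := ⟨0, Finset.mem_singleton_self 0⟩
  eq_of_sub_mem := fun x hx y hy _ => by
    rw [Finset.mem_singleton.1 hx, Finset.mem_singleton.1 hy]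

/-- The points of the integer chain are the points with integer coordinate. [folklore] -/
theorem mem_points_intChain {z : EuclideanSpace ℝ (Fin 1)} :
    z ∈ intChain.points ↔ ∃ k : ℤ, (k : ℝ) = z 0 := by
  constructor
  · rintro ⟨y, hy, g, hg, rfl⟩
    have hy0 : y = 0 := Finset.mem_singleton.1 hy
    obtain ⟨k, hk⟩ := (mem_stdIntLattice_iff g).1 hg 0
    exact ⟨k, by simp [hy0, hk]⟩
  · rintro ⟨k, hk⟩
    refine ⟨0, Finset.mem_singleton_self 0, z, (mem_stdIntLattice_iff z).2 fun j => ⟨k, ?_⟩,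
      (zero_add z).symm⟩
    fin_cases j
    exact hk

/-! ## Positional crystallization -/

/-- **Sticky particles on a line crystallize** (Blanc–Lewin formulation): for every sequence of
ground states `x^N` of `stickyPotential` in `ℝ¹` — unit chains `a_N, a_N + 1, …, a_N + N - 1` —
the translates by `τ_N = -a_N - ⌊N/2⌋` satisfy `∑ᵢ f(xᵢ^N + τ_N) → ∑_{k ∈ ℤ} f(k)` for every
compactly supported `f`; hence `IsCrystallizing stickyPotential 1`, with `φ = id`, limit
configuration `intChain` and multiplicity `m ≡ 1`. The one-dimensional shadow of Heitmann–Radin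
1980 (`d = 2`); Blanc–Lewin 2015, §2.3. [folklore] -/
theorem isCrystallizing_stickyPotential_one : IsCrystallizing stickyPotential 1 := by
  classical
  intro x hx
  choose a ha using fun N => (hx N).exists_eq_add_of_stickyPotential.2
  refine ⟨id, fun N => EuclideanSpace.single 0 (-a N - (((N / 2 : ℕ) : ℝ))), intChain, fun _ => 1,
    strictMono_id, fun _ _ => le_rfl, fun _ _ _ => rfl, fun f _ hf => ?_⟩
  refine intChain.tendsto_sum_of_eventually_card_eq (fun _ => 1) (n := id)
    (fun N i => x N i + EuclideanSpace.single 0 (-a N - (((N / 2 : ℕ) : ℝ)))) (fun R => ?_) hf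
  refine eventually_atTop.2 ⟨2 * (⌈R⌉₊ + 1), fun N hN s hs => ?_⟩
  have ht := injective_coord (hx N).1
  -- coordinates of the translated particles
  have hcoord : ∀ i, (x N i + EuclideanSpace.single 0 (-a N - (((N / 2 : ℕ) : ℝ))) :
      EuclideanSpace ℝ (Fin 1)) 0 = x N i 0 - a N - ((N / 2 : ℕ) : ℝ) := fun i => by
    simp only [PiLp.add_apply, PiLp.single_apply, ↓reduceIte]
    ring
  by_cases hsP : s ∈ intChain.points
  · -- an integer point `k` of the ball: occupied exactly by the particle of rank `k + ⌊N/2⌋`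
    rw [if_pos hsP]
    obtain ⟨k, hk⟩ := mem_points_intChain.1 hsP
    have hkR : |(k : ℝ)| ≤ ⌈R⌉₊ := by
      rw [hk, ← norm_eq_abs]; exact hs.trans (Nat.le_ceil R)
    have hkM : |k| ≤ (⌈R⌉₊ : ℤ) := by exact_mod_cast hkR
    obtain ⟨hk1, hk2⟩ := abs_le.1 hkM
    obtain ⟨k', hk'⟩ : ∃ k' : ℕ, (k' : ℤ) = k + (N / 2 : ℕ) := ⟨(k + (N / 2 : ℕ)).toNat, by omega⟩
    have hk'N : k' < N := by omega
    obtain ⟨i₀, hi₀⟩ := ha N k' hk'N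
    have hk'R : (k' : ℝ) = k + ((N / 2 : ℕ) : ℝ) := by
      have h := congrArg (fun z : ℤ => (z : ℝ)) hk'
      push_cast at h
      exact h
    refine Finset.card_eq_one.2 ⟨i₀, Finset.eq_singleton_iff_unique_mem.2 ⟨?_, fun i hi => ?_⟩⟩
    · simp only [Finset.mem_filter, Finset.mem_univ, true_and]
      refine ext_zero ?_
      rw [hcoord, hi₀, ← hk, hk'R]
      ring
    · have h1 := (Finset.mem_filter.1 hi).2
      have h2 : x N i 0 = x N i₀ 0 := by
        have := congrArg (fun v : EuclideanSpace ℝ (Fin 1) => v 0) h1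
        simp only [hcoord] at this
        rw [hi₀, hk'R]
        linarith [this, hk]
      exact ht h2
  · -- a non-integer point is never occupied
    rw [if_neg hsP]
    refine Finset.card_eq_zero.2 (Finset.filter_eq_empty_iff.2 fun i _ hi => hsP ?_)
    obtain ⟨k, -, hk⟩ := exists_lt_apply_eq_add ht (ha N) i
    refine mem_points_intChain.2 ⟨(k : ℤ) - ((N / 2 : ℕ) : ℤ), ?_⟩
    rw [← hi, hcoord, hk, Int.cast_sub, Int.cast_natCast, Int.cast_natCast]
    ring

/-! ## The energetic statement -/

namespace PeriodicConfiguration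

variable (Q : PeriodicConfiguration 1)

/-- Only finitely many points of a periodic configuration lie within distance `1` of `x`
(as a subset of the index type of the lattice sum in `energyPerParticle`). [folklore] -/
theorem finite_dist_le_one (x : EuclideanSpace ℝ (Fin 1)) :
    {y : {y // y ∈ Q.points ∧ y ≠ x} | dist x y.1 ≤ 1}.Finite := by
  have hfin := Q.finite_inter_points (isBounded_closedBall (x := x) (r := 1))
  refine (hfin.preimage Subtype.val_injective.injOn).subset fun y hy => ?_
  exact ⟨mem_closedBall'.2 hy, y.2.1⟩

/-- The sticky lattice sum around `x` is a finite sum (no `tsum` junk value). [folklore] -/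
theorem tsum_stickyPotential_eq_sum (x : EuclideanSpace ℝ (Fin 1)) :
    ∑' y : {y // y ∈ Q.points ∧ y ≠ x}, stickyPotential (dist x y.1) =
      ∑ y ∈ (Q.finite_dist_le_one x).toFinset, stickyPotential (dist x y.1) :=
  tsum_eq_sum (L := .unconditional _) fun _ hy =>
    stickyPotential_of_one_lt (not_le.1 fun h => hy ((Q.finite_dist_le_one x).mem_toFinset.2 h))

/-- On a line at most two points are at distance exactly `1` from `x` (the kissing number of
`ℝ¹` is `2`). [folklore] -/
theorem card_filter_dist_eq_one_le_two (x : EuclideanSpace ℝ (Fin 1))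
    (T : Finset {y // y ∈ Q.points ∧ y ≠ x}) :
    (T.filter fun y => dist x y.1 = 1).card ≤ 2 := by
  classical
  calc (T.filter fun y => dist x y.1 = 1).card ≤ ({x 0 + 1, x 0 - 1} : Finset ℝ).card :=
        Finset.card_le_card_of_injOn (fun y => y.1 0) (fun y hy => ?_)
          (fun _ _ _ _ h => Subtype.ext (ext_zero h))
    _ ≤ 2 := Finset.card_le_two
  have h := (Finset.mem_filter.1 hy).2
  rw [dist_eq_abs_sub] at h
  rcases (abs_eq zero_le_one).1 h with h | h
  · exact Finset.mem_insert_of_mem (Finset.mem_singleton.2 (by linarith))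
  · exact Finset.mem_insert.2 (Or.inl (by linarith))

/-- Each particle of a periodic configuration of the line has sticky energy `≥ -2`. [folklore] -/
theorem neg_two_le_tsum_stickyPotential (x : EuclideanSpace ℝ (Fin 1)) :
    -2 ≤ ∑' y : {y // y ∈ Q.points ∧ y ≠ x}, stickyPotential (dist x y.1) := by
  classical
  rw [Q.tsum_stickyPotential_eq_sum x]
  set T := (Q.finite_dist_le_one x).toFinset
  have hc : ((T.filter fun y => dist x y.1 = 1).card : ℝ) ≤ 2 := by
    exact_mod_cast Q.card_filter_dist_eq_one_le_two x T
  calc (-2 : ℝ) ≤ ∑ y ∈ T, -(if dist x y.1 = 1 then (1 : ℝ) else 0) := by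
        rw [Finset.sum_neg_distrib, Finset.sum_boole]; linarith
    _ ≤ ∑ y ∈ T, stickyPotential (dist x y.1) := Finset.sum_le_sum fun y _ => by
        rw [stickyPotential_eq]; split_ifs <;> norm_num

/-- **Lower bound over periodic configurations of the line**: the sticky energy per particle
(Blanc–Lewin 2015, (23)) is `≥ -1`. [folklore] -/
theorem neg_one_le_energyPerParticle_stickyPotential :
    -1 ≤ Q.energyPerParticle stickyPotential := by
  unfold energyPerParticle
  have hF : (0 : ℝ) < Q.motif.card := by exact_mod_cast Q.motif_nonempty.card_pos
  have hsum : ∑ _x ∈ Q.motif, (-2 : ℝ) ≤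
      ∑ x ∈ Q.motif, ∑' y : {y // y ∈ Q.points ∧ y ≠ x}, stickyPotential (dist x y.1) :=
    Finset.sum_le_sum fun x _ => Q.neg_two_le_tsum_stickyPotential x
  rw [Finset.sum_const, nsmul_eq_mul] at hsum
  have h2 : (0 : ℝ) ≤ (2 * (Q.motif.card : ℝ))⁻¹ := by positivity
  calc (-1 : ℝ) = (2 * (Q.motif.card : ℝ))⁻¹ * (Q.motif.card * (-2)) := by
        field_simp
    _ ≤ _ := mul_le_mul_of_nonneg_left hsum h2

end PeriodicConfiguration

/-- The sticky energy per particle of the integer chain is `-1` (two contacts per particle,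
each counted with the factor `1/2` of Blanc–Lewin 2015, (23)). [folklore] -/
theorem energyPerParticle_intChain : intChain.energyPerParticle stickyPotential = -1 := by
  classical
  unfold PeriodicConfiguration.energyPerParticle
  rw [show intChain.motif = {0} from rfl, Finset.sum_singleton, Finset.card_singleton]
  suffices h : ∑' y : {y // y ∈ intChain.points ∧ y ≠ 0},
      stickyPotential (dist (0 : EuclideanSpace ℝ (Fin 1)) y.1) = -2 by
    rw [h]; norm_num
  refine le_antisymm ?_ (intChain.neg_two_le_tsum_stickyPotential 0)
  rw [intChain.tsum_stickyPotential_eq_sum 0]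
  set T := (intChain.finite_dist_le_one 0).toFinset with hT
  -- no core pairs: points of `ℤ` other than `0` are at distance `≥ 1`
  have hterm : ∀ y ∈ T, stickyPotential (dist (0 : EuclideanSpace ℝ (Fin 1)) y.1) =
      -(if dist (0 : EuclideanSpace ℝ (Fin 1)) y.1 = 1 then (1 : ℝ) else 0) := by
    intro y _
    have h1 : 1 ≤ dist (0 : EuclideanSpace ℝ (Fin 1)) y.1 := by
      obtain ⟨k, hk⟩ := mem_points_intChain.1 y.2.1
      have hk0 : k ≠ 0 := fun h0 => y.2.2 (ext_zero (by rw [← hk, h0]; simp))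
      rw [dist_eq_abs_sub, ← hk, PiLp.zero_apply, zero_sub, abs_neg, ← Int.cast_abs]
      exact_mod_cast Int.one_le_abs hk0
    rw [stickyPotential_eq, if_neg (not_lt.2 h1)]
    ring
  rw [Finset.sum_congr rfl hterm, Finset.sum_neg_distrib, Finset.sum_boole, neg_le_neg_iff]
  -- two contacts: `±1`
  have hmem : ∀ σ : ℝ, σ = 1 ∨ σ = -1 →
      ∃ y ∈ T.filter (fun y => dist (0 : EuclideanSpace ℝ (Fin 1)) y.1 = 1), y.1 0 = σ := by
    intro σ hσ
    have hpt : (EuclideanSpace.single 0 σ : EuclideanSpace ℝ (Fin 1)) ∈ intChain.points := by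
      rcases hσ with rfl | rfl
      · exact mem_points_intChain.2 ⟨1, by simp⟩
      · exact mem_points_intChain.2 ⟨-1, by simp⟩
    have hdist : dist (0 : EuclideanSpace ℝ (Fin 1)) (EuclideanSpace.single 0 σ) = 1 := by
      rw [dist_eq_abs_sub, PiLp.zero_apply, PiLp.single_apply, if_pos rfl, zero_sub, abs_neg]
      rcases hσ with rfl | rfl <;> norm_num
    have hne : (EuclideanSpace.single 0 σ : EuclideanSpace ℝ (Fin 1)) ≠ 0 := by
      intro h
      rw [h, dist_self] at hdist
      exact zero_ne_one hdist
    exact ⟨⟨_, hpt, hne⟩, Finset.mem_filter.2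
      ⟨(intChain.finite_dist_le_one 0).mem_toFinset.2 hdist.le, hdist⟩, by simp⟩
  obtain ⟨y₁, hy₁, hy₁0⟩ := hmem 1 (Or.inl rfl)
  obtain ⟨y₂, hy₂, hy₂0⟩ := hmem (-1) (Or.inr rfl)
  have hne : y₁ ≠ y₂ := fun h => by
    have : y₁.1 0 = y₂.1 0 := by rw [h]
    rw [hy₁0, hy₂0] at this
    norm_num at this
  have : 1 < (T.filter fun y => dist (0 : EuclideanSpace ℝ (Fin 1)) y.1 = 1).card :=
    Finset.one_lt_card_iff.2 ⟨y₁, y₂, hy₁, hy₂, hne⟩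
  exact_mod_cast this

/-- `E(N)/N = -(N - 1)/N → -1` for sticky particles on a line (the limit `e_∞` of
Blanc–Lewin 2015, §1.3 (8)). [folklore] -/
theorem tendsto_groundStateEnergy_stickyPotential_div :
    Tendsto (fun N : ℕ => groundStateEnergy stickyPotential 1 N / N) atTop (𝓝 (-1)) := by
  have h : ∀ᶠ N : ℕ in atTop, -1 + ((N : ℝ))⁻¹ = groundStateEnergy stickyPotential 1 N / N := by
    refine eventually_atTop.2 ⟨1, fun N hN => ?_⟩
    rw [groundStateEnergy_stickyPotential_one hN]
    have : (N : ℝ) ≠ 0 := by exact_mod_cast Nat.pos_iff_ne_zero.1 hN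
    field_simp
    ring
  refine Tendsto.congr' h ?_
  simpa using tendsto_const_nhds.add (tendsto_inv_atTop_nhds_zero_nat (𝕜 := ℝ))

/-- **Energetic crystallization on a line**: for the sticky potential, `E(N)/N → e(ℤ) = -1`,
and `-1` is the least energy per particle over all periodic configurations of `ℝ¹`; hence
`HasPeriodicGroundStateEnergy stickyPotential 1` (the form of Blanc–Lewin 2015, §1.3 (8) and
§2.3). [folklore] -/
theorem hasPeriodicGroundStateEnergy_stickyPotential_one :
    HasPeriodicGroundStateEnergy stickyPotential 1 := by
  refine ⟨intChain, ⟨⟨intChain, rfl⟩, ?_⟩, ?_⟩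
  · rintro _ ⟨Q, rfl⟩
    rw [energyPerParticle_intChain]
    exact Q.neg_one_le_energyPerParticle_stickyPotential
  · rw [energyPerParticle_intChain]
    exact tendsto_groundStateEnergy_stickyPotential_div

/-- **The one-dimensional sticky analogue of `Crystallization` holds**: both the energetic and
the Blanc–Lewin positional statement, for `stickyPotential` in `ℝ¹` (whereas the conjunct
`Crystallization` — the same conjunction for Lennard-Jones in `ℝ³` — is open, Blanc–Lewin 2015,
§2.3). [folklore] -/
theorem crystallization_stickyPotential_one :
    HasPeriodicGroundStateEnergy stickyPotential 1 ∧ IsCrystallizing stickyPotential 1 :=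
  ⟨hasPeriodicGroundStateEnergy_stickyPotential_one, isCrystallizing_stickyPotential_one⟩

end Literature.MathematicalPhysics.StatisticalMechanics

end
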